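import Summits.QuantumFields.YangMills.Theorems.LuscherReductionRunningReductionLatticeLinkKernel
import HarnessLib

/-!
# The magnetic term near the vacuum in Frobenius-linear link coordinates: the plaquette cost is the lattice-curl quadratic form up to an
# explicit CUBIC remainder — `|(2 − Re tr U_p) − ½‖f₁ + f₂ − f₃ − f₄‖_F²| ≤ 6s³ + s⁴`, `fᵢ = Uᵢ − 1`, `s = Σ‖fᵢ‖_F`
# (brick (iii) of the fixed-lattice COARSE programme at the vacuum; lane B of S-BASE, crux `TwistedTraceScaling` stmt-QuantumFields-20203)

In the Frobenius-linear coordinates of `Theorems/…ElectricSplit.lean` the kinetic factor of the transfer kernel is an exact Gaussian; the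
magnetic factor `e^{−(β/2)S}` carries the semiclassics.  The Wilson action is a quartic POLYNOMIAL in the link matrices; this file proves the
first step of its near-vacuum analysis, for unitary `2×2` matrices `A₁ … A₄` with `fᵢ = Aᵢ − 1`:

* §1 the unit-sphere identities `f fᴴ = −(f + fᴴ)` and `Re tr f = −½‖f‖_F²` (so the "linear" term of the expansion is quadratic);
* §2 the exact expansion `2 − Re tr(A₁A₂A₃ᴴA₄ᴴ) = ½‖f₁ + f₂ − f₃ − f₄‖_F² + R` with
  `R = Re tr(f₁f₂f₂ᴴ) + Re tr(f₄f₃f₃ᴴ) − Re tr(cubic) − Re tr(f₁f₂f₃ᴴf₄ᴴ)` (`plaquetteCost_eq_quadratic_add`);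
* §3 ★ `abs_plaquetteCost_sub_quadratic_le`: `|R| ≤ 6s³ + s⁴`, `s = ‖f₁‖+‖f₂‖+‖f₃‖+‖f₄‖` (Hilbert–Schmidt Cauchy–Schwarz `|Re tr(XY)| ≤ ‖X‖‖Y‖`,
  submultiplicativity), and the `SU(2)` plaquette form ★ `abs_plaquetteTerm_sub_curl_sq_le` for `plaquetteHolonomy U x i j`:
  `|(2 − Re tr U_p) − ½‖F(x,i) + F(x+eᵢ,j) − F(x+eⱼ,i) − F(x,j)‖_F²| ≤ 6s_p³ + s_p⁴`, `F(e) = U_e − 1` — the quadratic form is the lattice curl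
  `½Σ_p ‖(dF)_p‖²` whose Hessian `d*d` (PSD, kernel = closed 1-forms = gauge ⊕ constant modes) is the `A` of the adiabatic stiff Gaussian.

HONEST FRAMING: exact finite-dimensional algebra + one inequality; no measure, no semiclassics; femto rung R2b1 (stub of a child of a CONDITIONAL
route); not a gap, not Clay.
-/

set_option autoImplicit false

noncomputable section

open scoped Matrix ComplexConjugate BigOperators
open Literature.MathematicalPhysics.QuantumFieldTheory
open Literature.MathematicalPhysics.QuantumLattice

namespace Summit.QuantumFields.YangMills.Theorems.FemtoTransferGap.TwoLattice.Magnetic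

open Summit.QuantumFields.YangMills.Theorems.FemtoTransferGap

/-! ## §1 Hilbert–Schmidt pairing and the unit-sphere identities -/

section Pairing

variable (x y : Matrix (Fin 2) (Fin 2) ℂ)

/-- `Re tr(Xᴴ) = Re tr X`. [folklore] -/
theorem re_trace_conjTranspose : (xᴴ.trace).re = (x.trace).re := by
  rw [Matrix.trace_conjTranspose, Complex.star_def, Complex.conj_re]

/-- `Re tr(Xᴴ Y) = Re tr(X Yᴴ)` (both are the Hilbert–Schmidt pairing `⟨X,Y⟩`). [cite: HornJohnson2013, (5.2.7)] -/
theorem re_trace_conjTranspose_mul : ((xᴴ * y).trace).re = ((x * yᴴ).trace).re := by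
  rw [← re_trace_conjTranspose (xᴴ * y), Matrix.conjTranspose_mul, Matrix.conjTranspose_conjTranspose, Matrix.trace_mul_comm]

/-- Symmetry of the pairing: `Re tr(X Yᴴ) = Re tr(Y Xᴴ)`. [cite: HornJohnson2013, (5.2.7)] -/
theorem re_trace_mul_conjTranspose_comm : ((x * yᴴ).trace).re = ((y * xᴴ).trace).re := by
  rw [← re_trace_conjTranspose (x * yᴴ), Matrix.conjTranspose_mul, Matrix.conjTranspose_conjTranspose]

/-- `‖X‖_F² = Re tr(X Xᴴ)`. [cite: HornJohnson2013, (5.2.7)] -/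
theorem frobNorm_sq_eq_re_trace' : frobNorm x ^ 2 = ((x * xᴴ).trace).re := by
  rw [frobNorm_sq_eq_re_trace, Matrix.trace_mul_comm]

/-- `|Re tr(X Y Z)| ≤ ‖X‖‖Y‖‖Z‖`. [folklore] -/
theorem abs_re_trace_mul_mul_le (z : Matrix (Fin 2) (Fin 2) ℂ) :
    |((x * y * z).trace).re| ≤ frobNorm x * frobNorm y * frobNorm z := by
  calc |((x * y * z).trace).re| ≤ frobNorm (x * y) * frobNorm z := abs_re_trace_mul_le _ _
    _ ≤ frobNorm x * frobNorm y * frobNorm z := mul_le_mul_of_nonneg_right (frobNorm_mul_le' x y) (frobNorm_nonneg _)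

/-- `|Re tr(X Y Z W)| ≤ ‖X‖‖Y‖‖Z‖‖W‖`. [folklore] -/
theorem abs_re_trace_mul_mul_mul_le (z w : Matrix (Fin 2) (Fin 2) ℂ) :
    |((x * y * z * w).trace).re| ≤ frobNorm x * frobNorm y * frobNorm z * frobNorm w := by
  calc |((x * y * z * w).trace).re| ≤ frobNorm (x * y * z) * frobNorm w := abs_re_trace_mul_le _ _
    _ ≤ frobNorm x * frobNorm y * frobNorm z * frobNorm w := by
        refine mul_le_mul_of_nonneg_right ?_ (frobNorm_nonneg _)
        exact (frobNorm_mul_le' _ _).trans (mul_le_mul_of_nonneg_right (frobNorm_mul_le' x y) (frobNorm_nonneg _))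

end Pairing

section Sphere

variable {A : Matrix (Fin 2) (Fin 2) ℂ}

/-- **Unit-sphere identity**: for `A Aᴴ = 1` and `f = A − 1`, `f fᴴ = −(f + fᴴ)`. [folklore] -/
theorem sub_one_mul_conjTranspose (hA : A * Aᴴ = 1) : (A - 1) * (A - 1)ᴴ = -((A - 1) + (A - 1)ᴴ) := by
  rw [Matrix.conjTranspose_sub, Matrix.conjTranspose_one]
  simp only [sub_mul, mul_sub, hA, one_mul, mul_one]
  abel

/-- **The linear term is quadratic on the sphere**: `Re tr(A − 1) = −½‖A − 1‖_F²` for `A Aᴴ = 1`. [cite: HornJohnson2013, (0.2.5)] -/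
theorem re_trace_sub_one (hA : A * Aᴴ = 1) : ((A - 1).trace).re = -(frobNorm (A - 1) ^ 2 / 2) := by
  have h := frobNorm_sq_eq_re_trace' (A - 1)
  rw [sub_one_mul_conjTranspose hA, Matrix.trace_neg, Matrix.trace_add, Complex.neg_re, Complex.add_re, re_trace_conjTranspose] at h
  linarith

/-- `Re tr(X fᴴ) = −Re tr(X f) − Re tr(X f fᴴ)` for `f = A − 1` on the sphere (`fᴴ = −f − f fᴴ`). [folklore] -/
theorem re_trace_mul_conjTranspose_sub_one (hA : A * Aᴴ = 1) (X : Matrix (Fin 2) (Fin 2) ℂ) :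
    ((X * (A - 1)ᴴ).trace).re = -((X * (A - 1)).trace).re - ((X * (A - 1) * (A - 1)ᴴ).trace).re := by
  have h : (A - 1)ᴴ = -(A - 1) - (A - 1) * (A - 1)ᴴ := by
    have := sub_one_mul_conjTranspose hA
    rw [this]; abel
  conv_lhs => rw [h]
  rw [mul_sub, mul_neg, Matrix.trace_sub, Matrix.trace_neg, Complex.sub_re, Complex.neg_re, Matrix.mul_assoc]

end Sphere

/-! ## §2 The exact expansion of the plaquette cost -/

section Expansion

variable (A₁ A₂ A₃ A₄ : Matrix (Fin 2) (Fin 2) ℂ)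

/-- The algebraic expansion `A₁A₂A₃ᴴA₄ᴴ = 1 + L + Q + C + f₁f₂f₃ᴴf₄ᴴ` in `fᵢ = Aᵢ − 1` (any ring). [folklore] -/
theorem prod_expand :
    A₁ * A₂ * A₃ᴴ * A₄ᴴ =
      1 + ((A₁ - 1) + (A₂ - 1) + (A₃ - 1)ᴴ + (A₄ - 1)ᴴ)
        + ((A₁ - 1) * (A₂ - 1) + (A₁ - 1) * (A₃ - 1)ᴴ + (A₁ - 1) * (A₄ - 1)ᴴ + (A₂ - 1) * (A₃ - 1)ᴴ + (A₂ - 1) * (A₄ - 1)ᴴ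
            + (A₃ - 1)ᴴ * (A₄ - 1)ᴴ)
        + ((A₁ - 1) * (A₂ - 1) * (A₃ - 1)ᴴ + (A₁ - 1) * (A₂ - 1) * (A₄ - 1)ᴴ + (A₁ - 1) * (A₃ - 1)ᴴ * (A₄ - 1)ᴴ
            + (A₂ - 1) * (A₃ - 1)ᴴ * (A₄ - 1)ᴴ)
        + (A₁ - 1) * (A₂ - 1) * (A₃ - 1)ᴴ * (A₄ - 1)ᴴ := by
  simp only [Matrix.conjTranspose_sub, Matrix.conjTranspose_one]
  noncomm_ring

/-- Polarisation of `½‖f₁ + f₂ − f₃ − f₄‖_F²` in the pairing `⟨X,Y⟩ = Re tr(X Yᴴ)`. [cite: HornJohnson2013, (5.2.7)] -/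
theorem frobNorm_sq_lincomb (f₁ f₂ f₃ f₄ : Matrix (Fin 2) (Fin 2) ℂ) :
    frobNorm (f₁ + f₂ - f₃ - f₄) ^ 2 =
      frobNorm f₁ ^ 2 + frobNorm f₂ ^ 2 + frobNorm f₃ ^ 2 + frobNorm f₄ ^ 2
        + 2 * ((f₁ * f₂ᴴ).trace).re - 2 * ((f₁ * f₃ᴴ).trace).re - 2 * ((f₁ * f₄ᴴ).trace).re
        - 2 * ((f₂ * f₃ᴴ).trace).re - 2 * ((f₂ * f₄ᴴ).trace).re + 2 * ((f₃ * f₄ᴴ).trace).re := by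
  have h21 := re_trace_mul_conjTranspose_comm f₂ f₁
  have h31 := re_trace_mul_conjTranspose_comm f₃ f₁
  have h41 := re_trace_mul_conjTranspose_comm f₄ f₁
  have h32 := re_trace_mul_conjTranspose_comm f₃ f₂
  have h42 := re_trace_mul_conjTranspose_comm f₄ f₂
  have h43 := re_trace_mul_conjTranspose_comm f₄ f₃
  rw [frobNorm_sq_eq_re_trace', frobNorm_sq_eq_re_trace' f₁, frobNorm_sq_eq_re_trace' f₂, frobNorm_sq_eq_re_trace' f₃,
    frobNorm_sq_eq_re_trace' f₄]
  simp only [Matrix.conjTranspose_add, Matrix.conjTranspose_sub, add_mul, sub_mul, mul_add, mul_sub, Matrix.trace_add,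
    Matrix.trace_sub, Complex.add_re, Complex.sub_re]
  linarith

/-- ★ **Exact expansion of the plaquette cost about the vacuum**: for unitary `Aᵢ` (`AᵢAᵢᴴ = 1`), `fᵢ = Aᵢ − 1`,
`2 − Re tr(A₁A₂A₃ᴴA₄ᴴ) = ½‖f₁ + f₂ − f₃ − f₄‖_F² + R`, `R = Re tr(f₁f₂f₂ᴴ) + Re tr(f₄f₃f₃ᴴ) − Re tr(cubic) − Re tr(f₁f₂f₃ᴴf₄ᴴ)`.
[cite: MontvayMunster1994, §3.2.3] [cite: Luscher1983, §3] -/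
theorem plaquetteCost_eq_quadratic_add (h₁ : A₁ * A₁ᴴ = 1) (h₂ : A₂ * A₂ᴴ = 1) (h₃ : A₃ * A₃ᴴ = 1) (h₄ : A₄ * A₄ᴴ = 1) :
    2 - ((A₁ * A₂ * A₃ᴴ * A₄ᴴ).trace).re =
      frobNorm ((A₁ - 1) + (A₂ - 1) - (A₃ - 1) - (A₄ - 1)) ^ 2 / 2 +
        ((((A₁ - 1) * (A₂ - 1) * (A₂ - 1)ᴴ).trace).re + (((A₄ - 1) * (A₃ - 1) * (A₃ - 1)ᴴ).trace).re
          - (((A₁ - 1) * (A₂ - 1) * (A₃ - 1)ᴴ + (A₁ - 1) * (A₂ - 1) * (A₄ - 1)ᴴ + (A₁ - 1) * (A₃ - 1)ᴴ * (A₄ - 1)ᴴ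
              + (A₂ - 1) * (A₃ - 1)ᴴ * (A₄ - 1)ᴴ).trace).re
          - (((A₁ - 1) * (A₂ - 1) * (A₃ - 1)ᴴ * (A₄ - 1)ᴴ).trace).re) := by
  set f₁ := A₁ - 1 with hf₁
  set f₂ := A₂ - 1 with hf₂
  set f₃ := A₃ - 1 with hf₃
  set f₄ := A₄ - 1 with hf₄
  -- the expansion and the trace of `1`
  have hexp := prod_expand A₁ A₂ A₃ A₄
  rw [← hf₁, ← hf₂, ← hf₃, ← hf₄] at hexp
  have htr1 : ((1 : Matrix (Fin 2) (Fin 2) ℂ).trace).re = 2 := by simp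
  -- sphere relations
  have r₁ : (f₁.trace).re = -(frobNorm f₁ ^ 2 / 2) := re_trace_sub_one h₁
  have r₂ : (f₂.trace).re = -(frobNorm f₂ ^ 2 / 2) := re_trace_sub_one h₂
  have r₃ : (f₃ᴴ.trace).re = -(frobNorm f₃ ^ 2 / 2) := by rw [re_trace_conjTranspose]; exact re_trace_sub_one h₃
  have r₄ : (f₄ᴴ.trace).re = -(frobNorm f₄ ^ 2 / 2) := by rw [re_trace_conjTranspose]; exact re_trace_sub_one h₄
  -- `Re tr(f₁f₂) = −⟨f₁,f₂⟩ − Re tr(f₁f₂f₂ᴴ)` and `Re tr(f₃ᴴf₄ᴴ) = Re tr(f₄f₃) = −⟨f₄,f₃⟩ − Re tr(f₄f₃f₃ᴴ)`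
  have s₂ : ((f₁ * f₂ᴴ).trace).re = -((f₁ * f₂).trace).re - ((f₁ * f₂ * f₂ᴴ).trace).re := re_trace_mul_conjTranspose_sub_one h₂ f₁
  have s₃ : ((f₄ * f₃ᴴ).trace).re = -((f₄ * f₃).trace).re - ((f₄ * f₃ * f₃ᴴ).trace).re := re_trace_mul_conjTranspose_sub_one h₃ f₄
  have s₃₄ : ((f₃ᴴ * f₄ᴴ).trace).re = ((f₄ * f₃).trace).re := by
    rw [← Matrix.conjTranspose_mul, re_trace_conjTranspose]
  have p₃₄ : ((f₃ * f₄ᴴ).trace).re = ((f₄ * f₃ᴴ).trace).re := re_trace_mul_conjTranspose_comm f₃ f₄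
  have hpol := frobNorm_sq_lincomb f₁ f₂ f₃ f₄
  rw [hexp]
  simp only [Matrix.trace_add, Complex.add_re, htr1]
  linarith

end Expansion

/-! ## §3 The cubic remainder bound -/

section Bound

variable (A₁ A₂ A₃ A₄ : Matrix (Fin 2) (Fin 2) ℂ)

/-- ★ **Quadratic approximation of the plaquette cost with an explicit cubic remainder**: for unitary `Aᵢ`, `fᵢ = Aᵢ − 1`,
`s = ‖f₁‖_F + ‖f₂‖_F + ‖f₃‖_F + ‖f₄‖_F`:  `|(2 − Re tr(A₁A₂A₃ᴴA₄ᴴ)) − ½‖f₁ + f₂ − f₃ − f₄‖_F²| ≤ 6s³ + s⁴`.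
[cite: MontvayMunster1994, §3.2.3] [cite: Luscher1983, §3] -/
theorem abs_plaquetteCost_sub_quadratic_le (h₁ : A₁ * A₁ᴴ = 1) (h₂ : A₂ * A₂ᴴ = 1) (h₃ : A₃ * A₃ᴴ = 1) (h₄ : A₄ * A₄ᴴ = 1) :
    |(2 - ((A₁ * A₂ * A₃ᴴ * A₄ᴴ).trace).re) - frobNorm ((A₁ - 1) + (A₂ - 1) - (A₃ - 1) - (A₄ - 1)) ^ 2 / 2| ≤
      6 * (frobNorm (A₁ - 1) + frobNorm (A₂ - 1) + frobNorm (A₃ - 1) + frobNorm (A₄ - 1)) ^ 3 +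
        (frobNorm (A₁ - 1) + frobNorm (A₂ - 1) + frobNorm (A₃ - 1) + frobNorm (A₄ - 1)) ^ 4 := by
  rw [plaquetteCost_eq_quadratic_add A₁ A₂ A₃ A₄ h₁ h₂ h₃ h₄, add_sub_cancel_left]
  simp only [Matrix.trace_add, Complex.add_re]
  have ha0 : 0 ≤ frobNorm (A₁ - 1) := frobNorm_nonneg _
  have hb0 : 0 ≤ frobNorm (A₂ - 1) := frobNorm_nonneg _
  have hc0 : 0 ≤ frobNorm (A₃ - 1) := frobNorm_nonneg _
  have hd0 : 0 ≤ frobNorm (A₄ - 1) := frobNorm_nonneg _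
  have hb' : frobNorm (A₂ - 1)ᴴ = frobNorm (A₂ - 1) := frobNorm_conjTranspose _
  have hc' : frobNorm (A₃ - 1)ᴴ = frobNorm (A₃ - 1) := frobNorm_conjTranspose _
  have hd' : frobNorm (A₄ - 1)ᴴ = frobNorm (A₄ - 1) := frobNorm_conjTranspose _
  -- the seven monomials
  have t1 := abs_re_trace_mul_mul_le (A₁ - 1) (A₂ - 1) (A₂ - 1)ᴴ
  have t2 := abs_re_trace_mul_mul_le (A₄ - 1) (A₃ - 1) (A₃ - 1)ᴴ
  have t3 := abs_re_trace_mul_mul_le (A₁ - 1) (A₂ - 1) (A₃ - 1)ᴴ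
  have t4 := abs_re_trace_mul_mul_le (A₁ - 1) (A₂ - 1) (A₄ - 1)ᴴ
  have t5 := abs_re_trace_mul_mul_le (A₁ - 1) (A₃ - 1)ᴴ (A₄ - 1)ᴴ
  have t6 := abs_re_trace_mul_mul_le (A₂ - 1) (A₃ - 1)ᴴ (A₄ - 1)ᴴ
  have t7 := abs_re_trace_mul_mul_mul_le (A₁ - 1) (A₂ - 1) (A₃ - 1)ᴴ (A₄ - 1)ᴴ
  rw [hb'] at t1
  rw [hc'] at t2 t3
  rw [hd'] at t4
  rw [hc', hd'] at t5 t6 t7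
  -- abbreviate the four norms and their sum
  generalize frobNorm (A₁ - 1) = a at *
  generalize frobNorm (A₂ - 1) = b at *
  generalize frobNorm (A₃ - 1) = c at *
  generalize frobNorm (A₄ - 1) = d at *
  have hs0 : 0 ≤ a + b + c + d := by positivity
  have m3 : ∀ x y z : ℝ, 0 ≤ x → x ≤ a + b + c + d → 0 ≤ y → y ≤ a + b + c + d → 0 ≤ z → z ≤ a + b + c + d →
      x * y * z ≤ (a + b + c + d) ^ 3 := fun x y z hx hxs hy hys hz hzs => by
    calc x * y * z ≤ (a + b + c + d) * (a + b + c + d) * (a + b + c + d) :=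
          mul_le_mul (mul_le_mul hxs hys hy hs0) hzs hz (by positivity)
      _ = (a + b + c + d) ^ 3 := by ring
  have has : a ≤ a + b + c + d := by linarith
  have hbs : b ≤ a + b + c + d := by linarith
  have hcs : c ≤ a + b + c + d := by linarith
  have hds : d ≤ a + b + c + d := by linarith
  have m4 : a * b * c * d ≤ (a + b + c + d) ^ 4 := by
    calc a * b * c * d ≤ (a + b + c + d) ^ 3 * (a + b + c + d) :=
          mul_le_mul (m3 a b c ha0 has hb0 hbs hc0 hcs) hds hd0 (by positivity)
      _ = (a + b + c + d) ^ 4 := by ring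
  have e1 := m3 a b b ha0 has hb0 hbs hb0 hbs
  have e2 := m3 d c c hd0 hds hc0 hcs hc0 hcs
  have e3 := m3 a b c ha0 has hb0 hbs hc0 hcs
  have e4 := m3 a b d ha0 has hb0 hbs hd0 hds
  have e5 := m3 a c d ha0 has hc0 hcs hd0 hds
  have e6 := m3 b c d hb0 hbs hc0 hcs hd0 hds
  obtain ⟨t1l, t1u⟩ := abs_le.mp t1
  obtain ⟨t2l, t2u⟩ := abs_le.mp t2
  obtain ⟨t3l, t3u⟩ := abs_le.mp t3
  obtain ⟨t4l, t4u⟩ := abs_le.mp t4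
  obtain ⟨t5l, t5u⟩ := abs_le.mp t5
  obtain ⟨t6l, t6u⟩ := abs_le.mp t6
  obtain ⟨t7l, t7u⟩ := abs_le.mp t7
  rw [abs_le]
  constructor <;> linarith

end Bound

/-! ## §4 The `SU(2)` plaquette of the torus -/

section Plaquette

variable {L : ℕ}

/-- For `W ∈ SU(2)`: `W Wᴴ = 1`. [folklore] -/
theorem su2_mul_conjTranspose (W : SU2) : (W : Matrix (Fin 2) (Fin 2) ℂ) * (W : Matrix (Fin 2) (Fin 2) ℂ)ᴴ = 1 := by
  rw [← Matrix.star_eq_conjTranspose]; exact Matrix.mem_unitaryGroup_iff.1 (su2_mem_unitaryGroup W)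

/-- The inverse in `SU(2)` is the conjugate transpose. [folklore] -/
theorem su2_coe_inv (W : SU2) : ((W⁻¹ : SU2) : Matrix (Fin 2) (Fin 2) ℂ) = (W : Matrix (Fin 2) (Fin 2) ℂ)ᴴ := by
  rw [← Matrix.star_eq_inv, Matrix.specialUnitaryGroup.coe_star, Matrix.star_eq_conjTranspose]

/-- The plaquette holonomy as a matrix product `U₁U₂U₃ᴴU₄ᴴ`. [folklore] -/
theorem coe_plaquetteHolonomy (U : GaugeConfig 3 L SU2) (x : Site 3 L) (i j : Fin 3) :
    ((plaquetteHolonomy U x i j : SU2) : Matrix (Fin 2) (Fin 2) ℂ) =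
      (U (x, i) : Matrix (Fin 2) (Fin 2) ℂ) * (U (x.shift i, j) : Matrix (Fin 2) (Fin 2) ℂ) *
        (U (x.shift j, i) : Matrix (Fin 2) (Fin 2) ℂ)ᴴ * (U (x, j) : Matrix (Fin 2) (Fin 2) ℂ)ᴴ := by
  unfold plaquetteHolonomy
  rw [Submonoid.coe_mul, Submonoid.coe_mul, Submonoid.coe_mul, su2_coe_inv, su2_coe_inv]

/-- ★ **The `SU(2)` plaquette cost is the squared lattice curl up to a cubic remainder**: with `F(e) = U_e − 1` and
`s_p = Σ_{e ∈ p} ‖F(e)‖_F`,  `|(2 − Re tr U_p) − ½‖F(x,i) + F(x+eᵢ,j) − F(x+eⱼ,i) − F(x,j)‖_F²| ≤ 6 s_p³ + s_p⁴`.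
[cite: MontvayMunster1994, §3.2.3] [cite: Luscher1983, §3] -/
theorem abs_plaquetteTerm_sub_curl_sq_le (U : GaugeConfig 3 L SU2) (x : Site 3 L) (i j : Fin 3) :
    |(2 - ((su2Rep (plaquetteHolonomy U x i j)).trace).re) -
        frobNorm (((U (x, i) : Matrix (Fin 2) (Fin 2) ℂ) - 1) + ((U (x.shift i, j) : Matrix (Fin 2) (Fin 2) ℂ) - 1)
          - ((U (x.shift j, i) : Matrix (Fin 2) (Fin 2) ℂ) - 1) - ((U (x, j) : Matrix (Fin 2) (Fin 2) ℂ) - 1)) ^ 2 / 2| ≤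
      6 * (frobNorm ((U (x, i) : Matrix (Fin 2) (Fin 2) ℂ) - 1) + frobNorm ((U (x.shift i, j) : Matrix (Fin 2) (Fin 2) ℂ) - 1)
          + frobNorm ((U (x.shift j, i) : Matrix (Fin 2) (Fin 2) ℂ) - 1) + frobNorm ((U (x, j) : Matrix (Fin 2) (Fin 2) ℂ) - 1)) ^ 3 +
        (frobNorm ((U (x, i) : Matrix (Fin 2) (Fin 2) ℂ) - 1) + frobNorm ((U (x.shift i, j) : Matrix (Fin 2) (Fin 2) ℂ) - 1)
          + frobNorm ((U (x.shift j, i) : Matrix (Fin 2) (Fin 2) ℂ) - 1) + frobNorm ((U (x, j) : Matrix (Fin 2) (Fin 2) ℂ) - 1)) ^ 4 := by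
  rw [fundamentalRep_apply, coe_plaquetteHolonomy]
  exact abs_plaquetteCost_sub_quadratic_le _ _ _ _ (su2_mul_conjTranspose _) (su2_mul_conjTranspose _)
    (su2_mul_conjTranspose _) (su2_mul_conjTranspose _)

end Plaquette

end Summit.QuantumFields.YangMills.Theorems.FemtoTransferGap.TwoLattice.Magnetic

end
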